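import Mathlib
import HarnessLib
import Summits.HubbardSuperconductivity.HubbardSuperconductivity.Theorems.KLProgrammeKLRegimeEngineV8E5CarrierSplit
import Summits.HubbardSuperconductivity.HubbardSuperconductivity.Theorems.KLProgrammeKLRegimeWickCrossContractionNorms

/-!
# Route `KLProgramme` — ENGINE child gen 8 (stmt-HubbardSuperconductivity-20437 `KLRegimeEngineV17F2`), SKELETON v2 class #3, (RA-U) SUPPLIER part 3b-iv:
# the INPUT glue — from a levelled law `hubbardSectorKernelNorm F (prescribedTuples univ Ωe) G ≤ N(degree, levelCount Ωe)` to the doors' prescribed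
# input sizes `hB`, in ANY family; and the input `V = klE5Input` of the carrier (degree 2 absent)
# (cell gate-hubbard-kl, seat p5 g11; companion of …E5CarrierReadout; form-agnostic w.r.t. E1's (RA-U-a′) word — whatever law E1 reads out at the
# coarse families, THIS is how it enters `carrierStep_*` / `carrier_*_le`; serves E1's own block doors at `F = klAnisoFamily` equally)

The one-step doors read the input `G` through
`hB : imagTimeWeight^{2m′+1} · Σ_{σ : σ e = τ e ∀ e ∈ E} Σ_{x : x q = y} ‖sectorisedKernel F G (2m′+2) σ x‖ ≤ B (m′+1) Fc` (`q ∈ E`, `#E = Fc + 1`: the pinned leg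
is among the prescribed ones).  With the prescription `Ωe_E = (i ↦ if i ∈ E then some (τ i) else none)` this double sum IS the leg sum
`sectorLegSum ε (prescribedTuples univ Ωe_E) W q (τ q) y` of the levelled norm (`levelCount Ωe_E = #E`), hence `≤ hubbardSectorKernelNorm F (prescribedTuples univ Ωe_E) G`:

* §1 `levelCount_prescribeOn` (`= #E`), **`doorPinnedSum_le_hubbardSectorKernelNorm_prescribed`** (any family, any `G`, any degree `m+1`);
* §2 **`doorSizes_of_levelled`** — a levelled law `∀ m′ Ωe, ‖G‖_{F, Ωe, 2m′+2} ≤ N (m′+1) (levelCount Ωe)` gives the doors' `hB` with `B m″ Fc := N m″ (Fc+1)`;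
* §3 **`doorSizes_klE5Input_of_levelled`** — for the carrier's input `V = klE5Input … n₀`: a levelled law for `𝒱_{n₀}[K]` in degrees `≥ 4` ONLY gives `V`'s `hB`
  with `B m″ Fc := if m″ ≤ 1 then 0 else N m″ (Fc+1)` (degree `2` of `V` vanishes: `sectorisedKernel_klE5Input_two`; other degrees are `𝒱`'s:
  `sectorisedKernel_klE5Input_of_ne_two`), plus `0 ≤ B`.
Pure composition; no definitions, no named facts; nothing about the model's sizes is asserted; nothing asserts superconductivity.
-/

noncomputable section

namespace Summit.HubbardSuperconductivity.HubbardSuperconductivity.Theorems.KLRegimeSplit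

set_option linter.dupNamespace false -- summit = problem name (single-conjunct summit), D-0017

open Real Finset Literature.MathematicalPhysics.QuantumLattice Literature.Probability.LatticeModels GrassmannAlgebra Matrix
open Literature.MathematicalPhysics.QuantumLattice.FermiRG
open Summit.HubbardSuperconductivity.HubbardSuperconductivity.Theorems.KLProgrammeLegKernels
open Summit.HubbardSuperconductivity.HubbardSuperconductivity.Theorems.KLRegimeWick
open Summit.HubbardSuperconductivity.HubbardSuperconductivity.Theorems.EngineV8
open Summit.HubbardSuperconductivity.HubbardSuperconductivity.Theorems.TwoPointAssembly
open Summit.HubbardSuperconductivity.HubbardSuperconductivity.Theorems.TorusFourierL2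
open Summit.HubbardSuperconductivity.HubbardSuperconductivity.Theorems.DispersionFlow

/-! ## §1 The door's prescribed pinned sum is one leg sum of the levelled norm -/

section Generic

variable {L M N : ℕ} [NeZero L]

omit [NeZero L] in
/-- The prescription «`τ` on `E`, free elsewhere» has level count `#E`. [folklore] -/
theorem levelCount_prescribeOn {m : ℕ} (E : Finset (Fin (m + 1))) (τ : Fin (m + 1) → SectorLeg N) :
    levelCount (fun i : Fin (m + 1) => if i ∈ E then some (τ i) else none) = E.card := by
  classical
  unfold levelCount
  congr 1
  ext i
  simp only [mem_filter, mem_univ, true_and]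
  split_ifs with h
  · simp [h]
  · simp [h]

/-- **The door's prescribed pinned sum is dominated by the levelled norm**, any family `F`, any `G`, any degree `m+1`: for `q ∈ E`,
`ε^m · Σ_{σ : σ e = τ e ∀ e ∈ E} Σ_{x : x q = y} ‖sectorisedKernel F G (m+1) σ x‖ ≤ hubbardSectorKernelNorm F (prescribedTuples univ Ωe_E) G`,
`Ωe_E i = if i ∈ E then some (τ i) else none` (the double sum is `sectorLegSum … q (τ q) y`, then `sectorLegSum_le_sectorisedKernelNorm`).
[cite: BenfattoGiulianiMastropietro2006, §2.8 (2.76)-(2.77)] -/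
theorem doorPinnedSum_le_hubbardSectorKernelNorm_prescribed {β : ℝ} (hβ : 0 ≤ β) (F : Fin N → FreqMomentum L M → ℂ) (G : HubbardGrassmann L M)
    {m : ℕ} (E : Finset (Fin (m + 1))) (τ : Fin (m + 1) → SectorLeg N) (q : Fin (m + 1)) (hq : q ∈ E) (y : SpaceTimeIdx L M) :
    imagTimeWeight β M ^ m *
        ∑ σ ∈ univ.filter (fun σ : Fin (m + 1) → SectorLeg N => ∀ e ∈ E, σ e = τ e),
          ∑ x ∈ univ.filter (fun x : Fin (m + 1) → SpaceTimeIdx L M => x q = y), ‖sectorisedKernel L M β F G (m + 1) σ x‖ ≤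
      hubbardSectorKernelNorm L M β F (prescribedTuples univ (fun i : Fin (m + 1) => if i ∈ E then some (τ i) else none)) G := by
  classical
  have _ := hβ
  rw [hubbardSectorKernelNorm_def]
  refine le_trans (le_of_eq ?_) (sectorLegSum_le_sectorisedKernelNorm (imagTimeWeight β M) _ (sectorisedKernel L M β F G (m + 1)) q (τ q) y)
  rw [sectorLegSum_def, ← mul_sum]
  congr 1
  refine sum_congr ?_ fun _ _ => rfl
  ext σ
  simp only [prescribedTuples, mem_filter, mem_univ, true_and]
  constructor
  · intro h
    refine ⟨fun i s hs => ?_, h q hq⟩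
    by_cases hi : i ∈ E
    · rw [if_pos hi, Option.mem_some_iff] at hs
      rw [← hs]; exact h i hi
    · rw [if_neg hi] at hs
      exact absurd hs (Option.not_mem_none s)
  · rintro ⟨h, -⟩ e he
    exact h e (τ e) (by rw [if_pos he]; exact Option.mem_some_iff.2 rfl)

/-! ## §2 From a levelled law to the doors' input sizes -/

/-- **A levelled law gives the doors' prescribed input sizes**: if `‖G‖_{F, prescribedTuples univ Ωe, 2m′+2} ≤ N (m′+1) (levelCount Ωe)` for all `m′, Ωe`, then the
`hB` hypothesis of the prescribed doors holds for `G` with `B m″ Fc := N m″ (Fc + 1)` (the pinned leg is one of the `Fc + 1` prescribed ones). [folklore] -/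
theorem doorSizes_of_levelled {β : ℝ} (hβ : 0 ≤ β) (F : Fin N → FreqMomentum L M → ℂ) (G : HubbardGrassmann L M) (Nf : ℕ → ℕ → ℝ)
    (hN : ∀ (m' : ℕ) (Ωe : Fin (2 * m' + 1 + 1) → Option (SectorLeg N)),
      hubbardSectorKernelNorm L M β F (prescribedTuples univ Ωe) G ≤ Nf (m' + 1) (levelCount Ωe)) :
    ∀ (m' Fc : ℕ) (E : Finset (Fin (2 * m' + 1 + 1))) (τ : Fin (2 * m' + 1 + 1) → SectorLeg N) (q : Fin (2 * m' + 1 + 1)),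
      q ∈ E → E.card = Fc + 1 → ∀ y : SpaceTimeIdx L M,
        imagTimeWeight β M ^ (2 * m' + 1) *
          ∑ σ ∈ univ.filter (fun σ : Fin (2 * m' + 1 + 1) → SectorLeg N => ∀ e ∈ E, σ e = τ e),
            ∑ x ∈ univ.filter (fun x : Fin (2 * m' + 1 + 1) → SpaceTimeIdx L M => x q = y),
              ‖sectorisedKernel L M β F G (2 * m' + 1 + 1) σ x‖ ≤ Nf (m' + 1) (Fc + 1) := by
  intro m' Fc E τ q hq hE y
  refine (doorPinnedSum_le_hubbardSectorKernelNorm_prescribed hβ F G E τ q hq y).trans ?_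
  have h := hN m' (fun i : Fin (2 * m' + 1 + 1) => if i ∈ E then some (τ i) else none)
  rwa [levelCount_prescribeOn, hE] at h

end Generic

/-! ## §3 The carrier's input: degree `2` absent, other degrees read off `𝒱_{n₀}[K]` -/

section Input

variable {L M N : ℕ} [NeZero L] (β U μ : ℝ) (K : TrigPolyC4v) (n₀ : ℕ)

/-- **The doors' input sizes of `V = klE5Input … n₀` from a levelled law for `𝒱_{n₀}[K]` in degrees `≥ 4` only** (any family `F`, e.g. a point-augmented
aniso family of a coarse level — input (a) of the (RA-U) supplier in E1's read-out currency): `hB` holds for `V` with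
`B m″ Fc := if m″ ≤ 1 then 0 else N m″ (Fc + 1)`; degree `2` of `V` is absent. [folklore] -/
theorem doorSizes_klE5Input_of_levelled (hβ : 0 ≤ β) (F : Fin N → FreqMomentum L M → ℂ) (Nf : ℕ → ℕ → ℝ)
    (hN : ∀ (m' : ℕ), 1 ≤ m' → ∀ (Ωe : Fin (2 * m' + 1 + 1) → Option (SectorLeg N)),
      hubbardSectorKernelNorm L M β F (prescribedTuples univ Ωe) (klEffectiveAction L M β U μ K klE0 n₀) ≤ Nf (m' + 1) (levelCount Ωe)) :
    ∀ (m' Fc : ℕ) (E : Finset (Fin (2 * m' + 1 + 1))) (τ : Fin (2 * m' + 1 + 1) → SectorLeg N) (q : Fin (2 * m' + 1 + 1)),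
      q ∈ E → E.card = Fc + 1 → ∀ y : SpaceTimeIdx L M,
        imagTimeWeight β M ^ (2 * m' + 1) *
          ∑ σ ∈ univ.filter (fun σ : Fin (2 * m' + 1 + 1) → SectorLeg N => ∀ e ∈ E, σ e = τ e),
            ∑ x ∈ univ.filter (fun x : Fin (2 * m' + 1 + 1) → SpaceTimeIdx L M => x q = y),
              ‖sectorisedKernel L M β F (klE5Input L M β U μ K n₀) (2 * m' + 1 + 1) σ x‖ ≤
          (fun m'' Fc' : ℕ => if m'' ≤ 1 then (0 : ℝ) else Nf m'' (Fc' + 1)) (m' + 1) Fc := by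
  intro m' Fc E τ q hq hE y
  rcases Nat.eq_zero_or_pos m' with hm | hm
  · -- degree 2: the kernels of `V` vanish
    subst hm
    have h0 : sectorisedKernel L M β F (klE5Input L M β U μ K n₀) (2 * 0 + 1 + 1) = 0 := sectorisedKernel_klE5Input_two β U μ K n₀ F
    simp only [h0, Pi.zero_apply, norm_zero, sum_const_zero, mul_zero, zero_add, le_refl, if_true]
  · -- degrees ≥ 4: `V`'s kernels are `𝒱`'s
    have hne : 2 * m' + 1 + 1 ≠ 2 := by omega
    have hle : ¬ m' + 1 ≤ 1 := by omega
    simp only [hle, if_false]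
    rw [sectorisedKernel_klE5Input_of_ne_two β U μ K n₀ F hne]
    refine (doorPinnedSum_le_hubbardSectorKernelNorm_prescribed hβ F _ E τ q hq y).trans ?_
    have h := hN m' hm (fun i : Fin (2 * m' + 1 + 1) => if i ∈ E then some (τ i) else none)
    rwa [levelCount_prescribeOn, hE] at h

omit [NeZero L] in
/-- The input size function of §3 is nonnegative when the law is. [folklore] -/
theorem doorSizes_klE5Input_nonneg {Nf : ℕ → ℕ → ℝ} (hN0 : ∀ m'' Fc, 0 ≤ Nf m'' Fc) (m'' Fc : ℕ) :
    0 ≤ (fun m'' Fc' : ℕ => if m'' ≤ 1 then (0 : ℝ) else Nf m'' (Fc' + 1)) m'' Fc := by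
  simp only
  split_ifs
  · exact le_rfl
  · exact hN0 _ _

end Input

end Summit.HubbardSuperconductivity.HubbardSuperconductivity.Theorems.KLRegimeSplit

end
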